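import Summits.QuantumFields.BalabanUV.T4Continuum.Support.ShellMeasureLandauDerivativeDecay
import Summits.QuantumFields.BalabanUV.T4Continuum.Support.ShellMeasureDecayKernelSums
import Literature.MathematicalPhysics.QuantumFieldTheory.Balaban1983to89.B7Ineq148

/-!
# `T4Continuum.ShellMeasureLandauDerivativeDecaySq` — WALL §2 (a) item (P4), row S67 file 2: (73) FROM END-II's ∕ S64's
# OWN BINDER PAIR — the (72)-TYPE input of file 1 DISCHARGED by the Cauchy estimate + LOCALITY, the bound UNIFORM ON
# THE BALL and LINEAR IN `‖A′‖`, delivered in the LITERAL input shape of the crew's S66 f3b (cell `pub-balaban`,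
# sub-cell `t4`, spine estimate NE7c (node U5b); NE7c ROUND-2 crew, unit `b2b-balaban-t4-ne7c-formalise-leaf-08`
# gen 12, owner table `LEAVES-NE7c-P1.md` row S67 (owner g30 GO); imports file 1 `ShellMeasureLandauDerivativeDecay`,
# the crew's S66 f3a `ShellMeasureDecayKernelSums` (p221973, for the `kerOp` junction) and the tree's `B7Ineq148` (the
# Cauchy estimate (148) TYPE) ONLY; [folklore]; 0 def, 0 `def … : Prop`, 0 sorry)

HONEST FRAMING.  Finite four-torus programme, rung (B)+1 only — NOT infinite volume, NOT a mass gap, NOT the Clay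
problem, NOT summit progress; (B), `BetaPertHyp`, (B^μ) are not consumed.  NE7c (`T4IndicatorShell.ShellWeightBound`)
is NOT PRINTED and NOT PROVED; «NE7c ⇐ the named binders» (WALL `t4/b2b-balaban-t4-ne7c-p1/WALL-NE7c-P1.md` §2).
Elementary calculus and finite sums on OUR side; nothing printed is asserted or cited as a fact.  HONEST DEPENDENCY
(cell): continuum YM on T⁴ ⇐ BetaPertH ∧ nine spine estimates (0/9 proved); BetaPertH ⇐ (D1) ∧ (D4) ∧ CAP+tail;
G-an2-4 gates asym, D1 and NE2/3/4.

THE POINT.  File 1 (`landauDerivative_decay_of_majorants`) derives [Balaban1985Variational] (73)'s SHAPE — the decay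
of the derivative kernel `𝔇(A′; c, b)` of the Landau correction `D` (fixed point of (49) `D(A′) = C(A′ − HD(A′))`) — from
a (72)-TYPE majorant of `𝒞 = DC(Y)` ([4] Prop. 5 TYPE), a (46)-TYPE majorant of `H` and the smallness `q < 1`.  HERE the
(72)-TYPE majorant is PRODUCED from END-II's own Landau-correction binder pair for `C` — `hCd : DifferentiableOn ℂ C
(ball 0 R)`, `hCq : ‖C Z‖ ≤ C₂‖Z‖²` (row S64 `ShellMeasureLandauCorrectionB7.landauCorrection_binders`: KERNEL for B7's
k-fold average, k-uniform) — by the Cauchy estimate on a complex line (`B7Ineq148.norm_fderiv_apply_le_of_sq_bound`: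
`‖DC(Y)δA‖ ≤ 4C₂‖Y‖‖δA‖` for `‖Y‖ < R∕2`; in the `ι_b` currency this IS a per-entry bound) together with the
structural LOCALITY of `C` (B7 (89) ∕ B11 p. 287: the average at a coarse bond `c` sees only the fine bonds of the two
adjacent blocks — `≤ m₀` bonds within distance `r₀`), which kills the off-block entries and makes the `e^{δd}`-weighted
row sum `≤ 8C₂‖A′‖·m₀e^{δr₀}`:
* §1 `fderiv_single_apply_eq_zero_of_local` (locality ⟹ `DC(Z)(ι_{b′} a) c = 0` off `loc c`, by the chain rule along
  the line `t ↦ Z + t·ι_{b′} a` on which `C(·) c` is constant); `norm_apply_le_of_weighted_majorant` (a weighted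
  majorant bounds the operator: `‖H X‖ ≤ h_w‖X‖` — the (46) sup constant `B₀` is dominated by the decay constant).
* §2 **`landauDerivative_decay_of_sq_bound`**: for EVERY `A′ ∈ ball 0 r` — with (55) `‖D A′‖ ≤ 4C₂‖A′‖²` (kernel along
  the ray in `ShellMeasureLandauFixedPoint`; a binder here), `4r ≤ R`, `4C₂h_w r ≤ 1` ((54)∕(58) TYPE) and
  `16C₂m₀e^{δr₀}h_w r ≤ 1` ((71) TYPE, `q ≤ ½`) — **`‖DD(A′)(ι_b a) c‖ ≤ 16C₂m₀e^{δr₀}·‖A′‖·e^{−δ·d(c,b)}·‖a‖`**: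
  (73) with «ε₃» replaced by `‖A′‖` (the display at every radius), constants EXPLICIT in (C₂, m₀, r₀, δ), no `#σ`, `#β`.
* §3 THE JUNCTION into the crew's S66 f3a∕f3b currency: `kerOp_entry` (`kerOp (entry T) = T` — every CLM between
  finite pi types is the operator of its kernel, so f3b's `hker : fderiv ℂ D A = kerOp (kD A)` holds with
  `kD A := entry (fderiv ℂ D A)` BY `rfl`-level bookkeeping) and `entry_fderiv_decay_of_sq_bound` = §2 in f3b's
  `hkD` shape `‖kD A c b‖ ≤ c₀·‖A‖·e^{−δ·d}` with `c₀ = 16C₂m₀e^{δr₀}` (instantiate `d` with the torus `pl1` distance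
  of `B12Decay510Torus` for `binders_of_decay_torus`).
* §4 NON-VACUITY: `H = 0`, `C Z = (Z ⋆)²` on one point — a genuinely nonlinear local `C` meeting every hypothesis.
NOT HERE (said): print's per-bond `η^{−d}` in (157)∕(72) is a PAIRING normalisation absent in the unweighted `ι_b`
currency ([dict]); the identification of `C`, `H`, `D` with Bałaban's sectioned `C_j(Lʲη·)`, `H`, `D` on `Ω_j` and the
`Lʲη`-scaling (node O ∕ row S63's bookkeeping); (46)'s decay, (55), locality and the smallness stay DISPLAYED-TYPE
binders; the `𝔇₂` remark (crew S66 f3c).  No estimate of Bałaban's at a live level is discharged; NOTHING in the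
countdown moves.
-/

noncomputable section

open Metric Set Filter Finset
open scoped Topology

namespace Summit.QuantumFields.BalabanUV.T4Continuum.ShellMeasureLandauDerivativeDecaySq

open Literature.MathematicalPhysics.QuantumFieldTheory.Balaban1983to89
open ShellMeasureDecayKernelSums (kerOp kerOp_apply)
open ShellMeasureLandauDerivativeDecay

/-! ## §1 Locality kills the off-block entries; a weighted majorant bounds the operator -/

section SqBound

variable {σ β : Type*} [Fintype σ] [Fintype β] [DecidableEq σ] [DecidableEq β]
variable {𝔄 : Type*} [NormedAddCommGroup 𝔄] [NormedSpace ℂ 𝔄]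

omit [DecidableEq σ] in
/-- **LOCALITY KILLS THE OFF-BLOCK ENTRIES.**  If the value `C Z c` depends only on the restriction of `Z` to a set
`loc` of fine bonds (B11 p. 287 ∕ B7 (89): the block average at `c` sees only the bonds of `B(c₋) ∪ B(c₊)`), then at
any point of differentiability the derivative entry along a fine bond `b′ ∉ loc` vanishes: `DC(Z)(ι_{b′} a) c = 0`.
[folklore] -/
theorem fderiv_single_apply_eq_zero_of_local {C : (β → 𝔄) → (σ → 𝔄)} {Z : β → 𝔄} {𝒞 : (β → 𝔄) →L[ℂ] (σ → 𝔄)}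
    (hC : HasFDerivAt C 𝒞 Z) (loc : Finset β) (c : σ)
    (hloc : ∀ Z Z' : β → 𝔄, (∀ b ∈ loc, Z b = Z' b) → C Z c = C Z' c) {b' : β} (hb' : b' ∉ loc) (a : 𝔄) :
    𝒞 (Pi.single b' a) c = 0 := by
  set v : β → 𝔄 := Pi.single b' a with hv
  -- the line `t ↦ Z + t•v` and the chain rule, read at the component `c`
  have h1 : HasDerivAt (fun t : ℂ => Z + t • v) v 0 := by
    simpa using ((hasDerivAt_id (0 : ℂ)).smul_const v).const_add Z
  have h2 : HasDerivAt (fun t : ℂ => C (Z + t • v)) (𝒞 v) 0 := by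
    have h := HasFDerivAt.comp_hasDerivAt_of_eq (f := fun t : ℂ => Z + t • v) (0 : ℂ) hC h1 (by simp)
    simpa [Function.comp_def] using h
  have h3 : HasDerivAt (fun t : ℂ => C (Z + t • v) c) (𝒞 v c) 0 := (hasDerivAt_pi.mp h2) c
  -- along that line the component `c` is constant, by locality
  have hconst : (fun t : ℂ => C (Z + t • v) c) = fun _ => C Z c := by
    funext t
    refine hloc _ _ fun b hb => ?_
    have hne : b ≠ b' := fun h => hb' (h ▸ hb)
    simp [hv, hne]
  rw [hconst] at h3
  exact h3.unique (hasDerivAt_const (0 : ℂ) (C Z c))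

omit [DecidableEq β] in
/-- A majorant with `e^{δd}`-weighted row sums `≤ h_w` (`δ ≥ 0`, `d ≥ 0`) bounds the operator in sup norm:
`‖H X‖ ≤ h_w‖X‖` — the (46)-TYPE operator bound `B₀` is dominated by the decay constant. [folklore] -/
theorem norm_apply_le_of_weighted_majorant {S : Type*} (d : S → S → ℝ) (hd0 : ∀ x y, 0 ≤ d x y)
    (pσ : σ → S) (pβ : β → S) {δ : ℝ} (hδ : 0 ≤ δ) (H : (σ → 𝔄) →L[ℂ] (β → 𝔄)) (h : β → σ → ℝ)
    (hh0 : ∀ b' c', 0 ≤ h b' c') (hh : ∀ c' a b', ‖H (Pi.single c' a) b'‖ ≤ h b' c' * ‖a‖) {hw : ℝ} (hhw0 : 0 ≤ hw)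
    (hhw : ∀ b', ∑ c', h b' c' * Real.exp (δ * d (pβ b') (pσ c')) ≤ hw) (X : σ → 𝔄) :
    ‖H X‖ ≤ hw * ‖X‖ := by
  refine (pi_norm_le_iff_of_nonneg (mul_nonneg hhw0 (norm_nonneg X))).mpr fun b' => ?_
  calc ‖H X b'‖ ≤ ∑ c', h b' c' * ‖X c'‖ := norm_apply_le_of_majorant H h hh X b'
    _ ≤ ∑ c', h b' c' * Real.exp (δ * d (pβ b') (pσ c')) * ‖X‖ :=
        Finset.sum_le_sum fun c' _ => by
          have h1 : h b' c' ≤ h b' c' * Real.exp (δ * d (pβ b') (pσ c')) :=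
            le_mul_of_one_le_right (hh0 b' c') (Real.one_le_exp (mul_nonneg hδ (hd0 _ _)))
          exact mul_le_mul h1 (norm_le_pi_norm X c') (norm_nonneg _)
            (mul_nonneg (hh0 _ _) (Real.exp_nonneg _))
    _ = (∑ c', h b' c' * Real.exp (δ * d (pβ b') (pσ c'))) * ‖X‖ := by rw [Finset.sum_mul]
    _ ≤ hw * ‖X‖ := mul_le_mul_of_nonneg_right (hhw b') (norm_nonneg X)

/-! ## §2 (73) from the square bound, analyticity and locality of `C` and the decay of `H`, uniformly on the ball -/

/-- **(73) FROM S64's BINDER PAIR, LOCALITY AND THE DECAY OF `H` — UNIFORMLY ON THE BALL, LINEAR IN `‖A′‖`.**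
Data on finite index sets `σ` (coarse) ∕ `β` (fine) placed in a pseudo-metric set (`d ≥ 0`, triangle inequality):
* `C` with END-II's ∕ S64's pair — `DifferentiableOn ℂ C (ball 0 R)` (hCd) and `‖C Z‖ ≤ C₂‖Z‖²` on the ball (hCq; B11
  (44)∕(52), [4] Prop. 4 TYPE) — and LOCAL: `C Z c` depends only on `Z` on `loc c`, `#loc c ≤ m₀`, `loc c` within
  distance `r₀` of `c` (B7 (89) TYPE, structural);
* `H` continuous linear with a majorant `h ≥ 0`, `e^{δd}`-weighted row sums `≤ h_w` ((46) = [5] Thm 3.12 TYPE, decay at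
  a rate above `δ` — the deep wall, DISPLAYED);
* `D` differentiable on `ball 0 r` with the fixed-point identity `D x = C(x − H(D x))` there ((49)∕(59)) and (55)
  `‖D A′‖ ≤ 4C₂‖A′‖²` (kernel in the tree along the ray: `ShellMeasureLandauFixedPoint`; here a binder);
* smallness `4r ≤ R`, `4C₂h_w r ≤ 1` ((54)∕(58) TYPE) and `16C₂m₀e^{δr₀}h_w r ≤ 1` ((71) TYPE `q ≤ ½`).
Then for EVERY `A′ ∈ ball 0 r`, every fine bond `b`, coarse bond `c` and `a`:
`‖DD(A′)(ι_b a) c‖ ≤ 16C₂m₀e^{δr₀}·‖A′‖·e^{−δ·d(c,b)}·‖a‖` — (73)'s SHAPE with «ε₃» replaced by `‖A′‖`; the (72)-TYPE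
input of `landauDerivative_decay` is DISCHARGED here by the Cauchy estimate `B7Ineq148.norm_fderiv_apply_le_of_sq_bound`
(p. 39's per-bond `η^{−d}` of (157) is a pairing normalisation absent in the `ι_b` currency — [dict]). [folklore] -/
theorem landauDerivative_decay_of_sq_bound {S : Type*} (d : S → S → ℝ) (hd0 : ∀ x y, 0 ≤ d x y)
    (htri : ∀ x y z, d x z ≤ d x y + d y z) (pσ : σ → S) (pβ : β → S) {δ : ℝ} (hδ : 0 ≤ δ)
    {C D : (β → 𝔄) → (σ → 𝔄)} (H : (σ → 𝔄) →L[ℂ] (β → 𝔄)) {R C₂ r : ℝ} (hC₂ : 0 ≤ C₂)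
    (hCd : DifferentiableOn ℂ C (ball 0 R)) (hCq : ∀ Z ∈ ball (0 : β → 𝔄) R, ‖C Z‖ ≤ C₂ * ‖Z‖ ^ 2)
    (loc : σ → Finset β) {m₀ : ℕ} {r₀ : ℝ} (hcard : ∀ c, (loc c).card ≤ m₀)
    (hdist : ∀ c, ∀ b' ∈ loc c, d (pσ c) (pβ b') ≤ r₀)
    (hloc : ∀ c, ∀ Z Z' : β → 𝔄, (∀ b ∈ loc c, Z b = Z' b) → C Z c = C Z' c)
    (h : β → σ → ℝ) (hh0 : ∀ b' c', 0 ≤ h b' c') (hh : ∀ c' a b', ‖H (Pi.single c' a) b'‖ ≤ h b' c' * ‖a‖)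
    {hw : ℝ} (hhw0 : 0 ≤ hw) (hhw : ∀ b', ∑ c', h b' c' * Real.exp (δ * d (pβ b') (pσ c')) ≤ hw)
    (hD : DifferentiableOn ℂ D (ball 0 r)) (hfix : ∀ x ∈ ball (0 : β → 𝔄) r, D x = C (x - H (D x)))
    (h55 : ∀ A ∈ ball (0 : β → 𝔄) r, ‖D A‖ ≤ 4 * C₂ * ‖A‖ ^ 2)
    (hrR : 4 * r ≤ R) (hsmall₁ : 4 * C₂ * hw * r ≤ 1) (hsmall₂ : 16 * C₂ * m₀ * Real.exp (δ * r₀) * hw * r ≤ 1)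
    {A : β → 𝔄} (hA : A ∈ ball (0 : β → 𝔄) r) (b : β) (a : 𝔄) (c : σ) :
    ‖fderiv ℂ D A (Pi.single b a) c‖ ≤
      16 * C₂ * m₀ * Real.exp (δ * r₀) * ‖A‖ * Real.exp (-(δ * d (pσ c) (pβ b))) * ‖a‖ := by
  have hAr : ‖A‖ < r := mem_ball_zero_iff.mp hA
  have hr0 : 0 < r := (norm_nonneg A).trans_lt hAr
  have hA0 := norm_nonneg A
  -- the point `Y = A − H(D A)` has `‖Y‖ ≤ 2‖A‖ < R∕2`
  have hHD : ‖H (D A)‖ ≤ ‖A‖ := by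
    calc ‖H (D A)‖ ≤ hw * ‖D A‖ := norm_apply_le_of_weighted_majorant d hd0 pσ pβ hδ H h hh0 hh hhw0 hhw (D A)
      _ ≤ hw * (4 * C₂ * ‖A‖ ^ 2) := mul_le_mul_of_nonneg_left (h55 A hA) hhw0
      _ = (4 * C₂ * hw * ‖A‖) * ‖A‖ := by ring
      _ ≤ (4 * C₂ * hw * r) * ‖A‖ := by gcongr
      _ ≤ 1 * ‖A‖ := mul_le_mul_of_nonneg_right hsmall₁ hA0
      _ = ‖A‖ := one_mul _
  set Y : β → 𝔄 := A - H (D A) with hY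
  have hY2 : ‖Y‖ ≤ 2 * ‖A‖ := by
    calc ‖Y‖ ≤ ‖A‖ + ‖H (D A)‖ := norm_sub_le _ _
      _ ≤ ‖A‖ + ‖A‖ := add_le_add le_rfl hHD
      _ = 2 * ‖A‖ := by ring
  have hYR : ‖Y‖ < R / 2 := by linarith
  have hYball : Y ∈ ball (0 : β → 𝔄) R := mem_ball_zero_iff.mpr (by linarith)
  -- derivatives and the fixed-point identity near `A`
  have hC : HasFDerivAt C (fderiv ℂ C Y) Y := (hCd.differentiableAt (isOpen_ball.mem_nhds hYball)).hasFDerivAt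
  have hDA : HasFDerivAt D (fderiv ℂ D A) A := (hD.differentiableAt (isOpen_ball.mem_nhds hA)).hasFDerivAt
  have hfixev : ∀ᶠ x in 𝓝 A, D x = C (x - H (D x)) :=
    Filter.eventually_of_mem (isOpen_ball.mem_nhds hA) hfix
  -- the (72)-TYPE majorant of `𝒞 = DC(Y)` by Cauchy + locality
  set g : ℝ := 8 * C₂ * ‖A‖ with hg
  have hg0 : 0 ≤ g := by positivity
  let γ : σ → β → ℝ := fun c b' => if b' ∈ loc c then g else 0
  have hγ0 : ∀ c b', 0 ≤ γ c b' := fun c b' => by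
    by_cases hb : b' ∈ loc c <;> simp [γ, hb, hg0]
  have hγ : ∀ b' a c, ‖fderiv ℂ C Y (Pi.single b' a) c‖ ≤ γ c b' * ‖a‖ := by
    intro b' a c
    by_cases hb : b' ∈ loc c
    · simp only [γ, hb, if_true]
      calc ‖fderiv ℂ C Y (Pi.single b' a) c‖ ≤ ‖fderiv ℂ C Y (Pi.single b' a)‖ := norm_le_pi_norm _ c
        _ ≤ 4 * C₂ * ‖Y‖ * ‖(Pi.single b' a : β → 𝔄)‖ :=
            B7Ineq148.norm_fderiv_apply_le_of_sq_bound hC₂ hCd hCq hYR _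
        _ = 4 * C₂ * ‖Y‖ * ‖a‖ := by rw [Pi.norm_single]
        _ ≤ 4 * C₂ * (2 * ‖A‖) * ‖a‖ := by gcongr
        _ = g * ‖a‖ := by rw [hg]; ring
    · simp only [γ, hb, if_false, zero_mul]
      rw [fderiv_single_apply_eq_zero_of_local hC (loc c) c (hloc c) hb a, norm_zero]
  have hγw : ∀ c, ∑ b', γ c b' * Real.exp (δ * d (pσ c) (pβ b')) ≤ g * (m₀ * Real.exp (δ * r₀)) := by
    intro c
    have hsplit : ∑ b', γ c b' * Real.exp (δ * d (pσ c) (pβ b'))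
        = ∑ b' ∈ loc c, g * Real.exp (δ * d (pσ c) (pβ b')) := by
      rw [← Finset.sum_filter_add_sum_filter_not Finset.univ (fun b' => b' ∈ loc c)]
      have hz : ∑ b' ∈ Finset.univ.filter (fun b' => ¬ b' ∈ loc c), γ c b' * Real.exp (δ * d (pσ c) (pβ b')) = 0 :=
        Finset.sum_eq_zero fun b' hb' => by
          simp only [Finset.mem_filter, Finset.mem_univ, true_and] at hb'
          simp [γ, hb']
      rw [hz, add_zero, Finset.filter_mem_eq_inter, Finset.univ_inter]
      exact Finset.sum_congr rfl fun b' hb' => by simp [γ, hb']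
    rw [hsplit]
    calc ∑ b' ∈ loc c, g * Real.exp (δ * d (pσ c) (pβ b'))
        ≤ ∑ b' ∈ loc c, g * Real.exp (δ * r₀) :=
          Finset.sum_le_sum fun b' hb' => mul_le_mul_of_nonneg_left
            (Real.exp_le_exp.mpr (mul_le_mul_of_nonneg_left (hdist c b' hb') hδ)) hg0
      _ = (loc c).card * (g * Real.exp (δ * r₀)) := by rw [Finset.sum_const, nsmul_eq_mul]
      _ ≤ m₀ * (g * Real.exp (δ * r₀)) :=
          mul_le_mul_of_nonneg_right (Nat.cast_le.mpr (hcard c)) (by positivity)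
      _ = g * (m₀ * Real.exp (δ * r₀)) := by ring
  -- the (71)-TYPE smallness: `q = γ_w·h_w ≤ ½`
  have hq : g * (m₀ * Real.exp (δ * r₀)) * hw ≤ 1 / 2 := by
    have h1 : g * (m₀ * Real.exp (δ * r₀)) * hw = (16 * C₂ * m₀ * Real.exp (δ * r₀) * hw * ‖A‖) / 2 := by
      rw [hg]; ring
    have h2 : 16 * C₂ * m₀ * Real.exp (δ * r₀) * hw * ‖A‖ ≤ 16 * C₂ * m₀ * Real.exp (δ * r₀) * hw * r :=
      mul_le_mul_of_nonneg_left hAr.le (by positivity)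
    rw [h1]; linarith
  have hq1 : g * (m₀ * Real.exp (δ * r₀)) * hw < 1 := by linarith
  -- file 1's theorem
  have key := landauDerivative_decay_of_majorants d htri pσ pβ hδ H hDA hC hfixev γ h hγ0 hh0 hγ hh hhw0 hγw hhw
    hq1 b a c
  -- `γ_w∕(1 − q) ≤ 2γ_w`
  have hK : g * (m₀ * Real.exp (δ * r₀)) / (1 - g * (m₀ * Real.exp (δ * r₀)) * hw)
      ≤ 16 * C₂ * m₀ * Real.exp (δ * r₀) * ‖A‖ := by
    rw [div_le_iff₀ (by linarith)]
    have h3 : 0 ≤ g * (m₀ * Real.exp (δ * r₀)) := by positivity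
    nlinarith
  calc ‖fderiv ℂ D A (Pi.single b a) c‖
      ≤ g * (m₀ * Real.exp (δ * r₀)) / (1 - g * (m₀ * Real.exp (δ * r₀)) * hw) *
          Real.exp (-(δ * d (pσ c) (pβ b))) * ‖a‖ := key
    _ ≤ 16 * C₂ * m₀ * Real.exp (δ * r₀) * ‖A‖ * Real.exp (-(δ * d (pσ c) (pβ b))) * ‖a‖ := by
        gcongr

end SqBound

/-! ## §3 The junction into the crew's S66 f3a∕f3b currency (`kerOp`, `hker`, `hkD`) -/

section Junction

variable {𝕜 : Type*} [RCLike 𝕜]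
variable {σ β : Type*} [Fintype σ] [Fintype β] [DecidableEq σ] [DecidableEq β]
variable {𝔄 𝔅 : Type*} [NormedAddCommGroup 𝔄] [NormedSpace 𝕜 𝔄] [NormedAddCommGroup 𝔅] [NormedSpace 𝕜 𝔅]

omit [Fintype σ] [DecidableEq σ] in
/-- EVERY continuous linear map between finite pi types IS the kernel operator (crew S66 f3a `kerOp`) of its entries:
`kerOp (entry T) = T`.  Hence f3b's hypothesis `hker : fderiv ℂ D A = kerOp (kD A)` holds with `kD A := entry (fderiv ℂ D
A)` for every differentiable `D`, with nothing to check. [folklore] -/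
theorem kerOp_entry (T : (β → 𝔄) →L[𝕜] (σ → 𝔅)) : kerOp (entry T) = T := by
  ext X c
  rw [kerOp_apply, apply_eq_sum_entry]

end Junction

section JunctionSq

variable {σ β : Type*} [Fintype σ] [Fintype β] [DecidableEq σ] [DecidableEq β]
variable {𝔄 : Type*} [NormedAddCommGroup 𝔄] [NormedSpace ℂ 𝔄]

/-- **§2 IN f3b's `hkD` SHAPE.**  Under the hypotheses of `landauDerivative_decay_of_sq_bound`, the derivative kernel
`kD A := entry (fderiv ℂ D A)` obeys `‖kD A c b‖ ≤ c₀·‖A‖·e^{−δ·d(c,b)}` on `ball 0 r` with `c₀ = 16C₂m₀e^{δr₀}` — the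
(73)-TYPE DISPLAY that `ShellMeasureDecayKernelBinders.binders_of_decay_torus` ∕ `prop4Hyp_termsHD_of_decay_torus`
take as INPUT (with `d` the torus `pl1` distance), now DERIVED from (hCq, hCd, locality, (46)-TYPE `h`, (55),
smallness). [folklore] -/
theorem entry_fderiv_decay_of_sq_bound {S : Type*} (d : S → S → ℝ) (hd0 : ∀ x y, 0 ≤ d x y)
    (htri : ∀ x y z, d x z ≤ d x y + d y z) (pσ : σ → S) (pβ : β → S) {δ : ℝ} (hδ : 0 ≤ δ)
    {C D : (β → 𝔄) → (σ → 𝔄)} (H : (σ → 𝔄) →L[ℂ] (β → 𝔄)) {R C₂ r : ℝ} (hC₂ : 0 ≤ C₂)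
    (hCd : DifferentiableOn ℂ C (ball 0 R)) (hCq : ∀ Z ∈ ball (0 : β → 𝔄) R, ‖C Z‖ ≤ C₂ * ‖Z‖ ^ 2)
    (loc : σ → Finset β) {m₀ : ℕ} {r₀ : ℝ} (hcard : ∀ c, (loc c).card ≤ m₀)
    (hdist : ∀ c, ∀ b' ∈ loc c, d (pσ c) (pβ b') ≤ r₀)
    (hloc : ∀ c, ∀ Z Z' : β → 𝔄, (∀ b ∈ loc c, Z b = Z' b) → C Z c = C Z' c)
    (h : β → σ → ℝ) (hh0 : ∀ b' c', 0 ≤ h b' c') (hh : ∀ c' a b', ‖H (Pi.single c' a) b'‖ ≤ h b' c' * ‖a‖)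
    {hw : ℝ} (hhw0 : 0 ≤ hw) (hhw : ∀ b', ∑ c', h b' c' * Real.exp (δ * d (pβ b') (pσ c')) ≤ hw)
    (hD : DifferentiableOn ℂ D (ball 0 r)) (hfix : ∀ x ∈ ball (0 : β → 𝔄) r, D x = C (x - H (D x)))
    (h55 : ∀ A ∈ ball (0 : β → 𝔄) r, ‖D A‖ ≤ 4 * C₂ * ‖A‖ ^ 2)
    (hrR : 4 * r ≤ R) (hsmall₁ : 4 * C₂ * hw * r ≤ 1) (hsmall₂ : 16 * C₂ * m₀ * Real.exp (δ * r₀) * hw * r ≤ 1) :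
    ∀ A ∈ ball (0 : β → 𝔄) r, ∀ (c : σ) (b : β),
      ‖entry (fderiv ℂ D A) c b‖ ≤
        (16 * C₂ * m₀ * Real.exp (δ * r₀)) * ‖A‖ * Real.exp (-(δ * d (pσ c) (pβ b))) := by
  intro A hA c b
  refine ContinuousLinearMap.opNorm_le_bound _ (by positivity) fun a => ?_
  rw [entry_apply]
  have key := landauDerivative_decay_of_sq_bound d hd0 htri pσ pβ hδ H hC₂ hCd hCq loc hcard hdist hloc h hh0 hh
    hhw0 hhw hD hfix h55 hrR hsmall₁ hsmall₂ hA b a c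
  calc ‖fderiv ℂ D A (Pi.single b a) c‖
      ≤ 16 * C₂ * m₀ * Real.exp (δ * r₀) * ‖A‖ * Real.exp (-(δ * d (pσ c) (pβ b))) * ‖a‖ := key
    _ = (16 * C₂ * m₀ * Real.exp (δ * r₀)) * ‖A‖ * Real.exp (-(δ * d (pσ c) (pβ b))) * ‖a‖ := by ring

end JunctionSq

/-! ## §4 Non-vacuity: a nonlinear local `C` on one point meeting every hypothesis of §2 -/

section Toy

/-- ONE coarse bond, ONE fine bond, scalar fibre `ℂ`; `C Z = (Z ⋆)²` (quadratic, entire, `‖C Z‖ = ‖Z‖²`: `C₂ = 1`,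
`R = 4`), LOCAL with `loc = {⋆}` (`m₀ = 1`, `r₀ = 0`); `H = 0` (majorant `h ≡ 0`, `h_w = 0`); `D = C` (the fixed-point
identity `D x = C(x − H(D x))` holds everywhere); (55) `‖D A′‖ = ‖A′‖² ≤ 4‖A′‖²`; `r = 1`: `4r ≤ R`, `4C₂h_w r = 0 ≤ 1`,
`16C₂m₀e^{0}h_w r = 0 ≤ 1`.  §2 applies and yields `‖DD(A′)(ι a) ⋆‖ ≤ 16‖A′‖‖a‖` on the unit ball — so the binder
shapes of `landauDerivative_decay_of_sq_bound` are jointly inhabited by a NONLINEAR `C`. [folklore] -/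
example (A : Unit → ℂ) (hA : A ∈ ball (0 : Unit → ℂ) 1) (a : ℂ) :
    ‖fderiv ℂ (fun Z : Unit → ℂ => fun _ : Unit => (Z ()) ^ 2) A (Pi.single () a) ()‖
      ≤ 16 * 1 * (1 : ℕ) * Real.exp (0 * 0) * ‖A‖ * Real.exp (-(0 * (fun _ _ : Unit => (0 : ℝ)) () ())) * ‖a‖ := by
  let C : (Unit → ℂ) → (Unit → ℂ) := fun Z _ => (Z ()) ^ 2
  have hCdiff : Differentiable ℂ C :=
    differentiable_pi.mpr fun _ => ((ContinuousLinearMap.proj (R := ℂ) (φ := fun _ : Unit => ℂ) ()).differentiable).pow 2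
  have hnormC : ∀ Z : Unit → ℂ, ‖C Z‖ = ‖Z‖ ^ 2 := by
    intro Z
    have h1 : ‖C Z‖ = ‖C Z ()‖ := by
      refine le_antisymm ((pi_norm_le_iff_of_nonneg (norm_nonneg _)).mpr fun u => le_of_eq rfl) (norm_le_pi_norm _ _)
    have h2 : ‖Z‖ = ‖Z ()‖ :=
      le_antisymm ((pi_norm_le_iff_of_nonneg (norm_nonneg _)).mpr fun u => le_of_eq rfl) (norm_le_pi_norm _ _)
    rw [h1, h2]
    simp [C, norm_pow]
  have key := landauDerivative_decay_of_sq_bound (σ := Unit) (β := Unit) (𝔄 := ℂ) (fun _ _ : Unit => (0 : ℝ))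
    (fun _ _ => le_rfl) (fun _ _ _ => by simp) id id (δ := 0) le_rfl (C := C) (D := C)
    (0 : (Unit → ℂ) →L[ℂ] (Unit → ℂ)) (R := 4) (C₂ := 1) (r := 1) zero_le_one hCdiff.differentiableOn
    (fun Z _ => by rw [hnormC, one_mul]) (fun _ => {()}) (m₀ := 1) (r₀ := 0) (fun _ => by simp)
    (fun _ _ _ => le_rfl) (fun c Z Z' hZZ' => by simp [C, hZZ' () (Finset.mem_singleton_self _)])
    (fun _ _ => 0) (fun _ _ => le_rfl) (fun c' a b' => by simp) (hw := 0) le_rfl (fun _ => by simp)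
    hCdiff.differentiableOn (fun x _ => by simp) (fun A _ => by rw [hnormC]; nlinarith [norm_nonneg A])
    (by norm_num) (by norm_num) (by norm_num) hA () a ()
  simpa [C] using key

end Toy

end Summit.QuantumFields.BalabanUV.T4Continuum.ShellMeasureLandauDerivativeDecaySq
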